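import Literature.Barriers.AtomisticToContinuum.DisorderedHarmonicChainInvGammaProofs
import Literature.Barriers.AtomisticToContinuum.DisorderedHarmonicChainPotential
import Mathlib.Probability.Moments.SubGaussian
import HarnessLib

/-!
# Ajanki–Huveneers 2011: exponential moments of predictable sums along the phase chain

Third file of the integration-by-parts route to the low-frequency upper bound (U) of
`…Transfer.lean` (O. Ajanki, F. Huveneers, CMP **301** (2011) 841–883, arXiv:1003.1076). The paper
controls sums `w ∑_k a(X_{k-1}) B_k` with predictable bounded coefficients by the exponential
martingale bounds of Freedman and Azuma (Lemma 4.2, App. 7.2) and uses them in Prop. 4.1,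
Lemma 5.5, Lemma 6.1. We vendor the tool in the form the next files consume, PROVED:

* `lintegral_exp_chainSum_le`: **first-step peeling** — if `sup_y ∫ e^{h(y,b)} τ(b)db ≤ θ` then
  `𝔼 exp(∑_{l<n} h(X^y_l, B_l)) ≤ θⁿ` for every start `y` (Markov property
  `X^y_{l+1}(b, B') = X^{f_b(y)}_l(B')` and Tonelli, as in `…InvGammaProofs.lean`);
* `lintegral_exp_le_of_linear_bound`: **Hoeffding's lemma** for the reduced law (`𝔼B = 0`,
  `B ∈ [b₋, b₊]`, from Mathlib's `hasSubgaussianMGF_of_mem_Icc_of_integral_eq_zero`):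
  `∫ e^{h(y,b)} τ db ≤ e^{K + s²A²/2}` whenever `h(y,b) ≤ a(y) b + K` on `[b₋, b₊]`, `|a| ≤ A`,
  `s = (b₊ - b₋)/2`;
* the combination `integral_exp_chainSum_le` / `integrable_exp_chainSum` (real-valued, with
  integrability) and the **Azuma-type tail bound** `measure_chainSum_ge_le`:
  `ℙ(∑_{l<n} a(X_l)B_l ≥ t) ≤ exp(-t²/(2ns²A²))`.

[cite: AjankiHuveneers2011, Lemma 4.2 eqs. (4.3)-(4.4) and App. 7.2 (Freedman's and Azuma's bounds)]
-/

noncomputable section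

open Real MeasureTheory ProbabilityTheory Finset
open scoped ENNReal

namespace Literature.Barriers.AtomisticToContinuum.HeatConduction

variable {τ : ℝ → ℝ} {bm bp : ℝ}

/-! ### The reduced law: a.e. support and Hoeffding's lemma -/

/-- `B ∈ [b₋, b₊]` almost surely under `ρ_B = τ(b)db`. [cite: AjankiHuveneers2011, §2 ¶1] -/
theorem ae_rhoB_mem_Icc (hτ : ReducedLawHyp τ bm bp) {ρB : Measure ℝ}
    (hρ : ρB = volume.withDensity fun s => ENNReal.ofReal (τ s)) :
    ∀ᵐ b ∂ρB, b ∈ Set.Icc bm bp := by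
  rw [ae_iff, hρ]
  show (volume.withDensity fun s => ENNReal.ofReal (τ s)) (Set.Icc bm bp)ᶜ = 0
  rw [withDensity_apply _ measurableSet_Icc.compl]
  have : ∀ s ∈ (Set.Icc bm bp)ᶜ, ENNReal.ofReal (τ s) = 0 := fun s hs => by
    rw [hτ.eq_zero s hs, ENNReal.ofReal_zero]
  rw [setLIntegral_congr_fun measurableSet_Icc.compl this, lintegral_zero]

/-- `𝔼 B = 0` under `ρ_B`. [cite: AjankiHuveneers2011, §2 ¶1 (`B_k = (M_k - 𝔼M)/𝔼M`)] -/
theorem integral_id_rhoB (hτ : ReducedLawHyp τ bm bp) {ρB : Measure ℝ}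
    (hρ : ρB = volume.withDensity fun s => ENNReal.ofReal (τ s)) : ∫ b, b ∂ρB = 0 := by
  rw [integral_rhoB hτ hρ]
  exact hτ.mean_zero

/-- **Hoeffding's lemma for the reduced law**: `∫ e^{tb} ρ_B(db) ≤ e^{s²t²/2}`, `s = (b₊-b₋)/2`.
[cite: AjankiHuveneers2011, Lemma 4.2 eq. (4.4) (Azuma's bound, one step)] -/
theorem integral_exp_mul_rhoB_le (hτ : ReducedLawHyp τ bm bp) {ρB : Measure ℝ} [IsProbabilityMeasure ρB]
    (hρ : ρB = volume.withDensity fun s => ENNReal.ofReal (τ s)) (t : ℝ) :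
    Integrable (fun b : ℝ => Real.exp (t * b)) ρB ∧
      ∫ b, Real.exp (t * b) ∂ρB ≤ Real.exp (((bp - bm) / 2) ^ 2 * t ^ 2 / 2) := by
  have hsg := hasSubgaussianMGF_of_mem_Icc_of_integral_eq_zero (X := fun b : ℝ => b) (μ := ρB)
    measurable_id.aemeasurable (ae_rhoB_mem_Icc hτ hρ) (integral_id_rhoB hτ hρ)
  refine ⟨hsg.integrable_exp_mul t, ?_⟩
  have h := hsg.mgf_le t
  simp only [mgf] at h
  have hs : ((‖bp - bm‖₊ / 2 : NNReal) : ℝ) = (bp - bm) / 2 := by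
    rw [NNReal.coe_div, coe_nnnorm, Real.norm_eq_abs, abs_of_pos (by linarith [hτ.lt])]
    norm_num
  calc ∫ b, Real.exp (t * b) ∂ρB ≤ Real.exp ((((‖bp - bm‖₊ / 2) ^ 2 : NNReal) : ℝ) * t ^ 2 / 2) := h
    _ = Real.exp (((bp - bm) / 2) ^ 2 * t ^ 2 / 2) := by rw [NNReal.coe_pow, hs]

/-- **One step with a linear majorant**: if `h(y,b) ≤ a(y) b + K` for `b ∈ [b₋, b₊]` and
`|a(y)| ≤ A`, then `∫ e^{h(y,b)} ρ_B(db) ≤ e^{K + s²A²/2}` in `ℝ≥0∞`.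
[cite: AjankiHuveneers2011, Lemma 4.2 (one step of Azuma's bound)] -/
theorem lintegral_exp_le_of_linear_bound (hτ : ReducedLawHyp τ bm bp) {ρB : Measure ℝ}
    [IsProbabilityMeasure ρB] (hρ : ρB = volume.withDensity fun s => ENNReal.ofReal (τ s))
    {h : ℝ → ℝ → ℝ} {a : ℝ → ℝ} {A K : ℝ} (hA : ∀ y, |a y| ≤ A)
    (hh : ∀ y, ∀ b ∈ Set.Icc bm bp, h y b ≤ a y * b + K) (y : ℝ) :
    ∫⁻ b, ENNReal.ofReal (Real.exp (h y b)) ∂ρB ≤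
      ENNReal.ofReal (Real.exp (K + ((bp - bm) / 2) ^ 2 * A ^ 2 / 2)) := by
  obtain ⟨hint, hle⟩ := integral_exp_mul_rhoB_le hτ hρ (a y)
  have hA0 : 0 ≤ A := (abs_nonneg _).trans (hA y)
  calc ∫⁻ b, ENNReal.ofReal (Real.exp (h y b)) ∂ρB
      ≤ ∫⁻ b, ENNReal.ofReal (Real.exp K * Real.exp (a y * b)) ∂ρB := by
        refine lintegral_mono_ae ?_
        filter_upwards [ae_rhoB_mem_Icc hτ hρ] with b hb
        refine ENNReal.ofReal_le_ofReal ?_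
        rw [← Real.exp_add]
        exact Real.exp_le_exp.mpr (by linarith [hh y b hb])
    _ = ENNReal.ofReal (∫ b, Real.exp K * Real.exp (a y * b) ∂ρB) := by
        rw [ofReal_integral_eq_lintegral_ofReal (hint.const_mul _)
          (ae_of_all _ fun b => by positivity)]
    _ ≤ ENNReal.ofReal (Real.exp (K + ((bp - bm) / 2) ^ 2 * A ^ 2 / 2)) := by
        refine ENNReal.ofReal_le_ofReal ?_
        rw [integral_const_mul, Real.exp_add]
        refine mul_le_mul_of_nonneg_left (hle.trans (Real.exp_le_exp.mpr ?_)) (Real.exp_pos _).le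
        have h1 : a y ^ 2 ≤ A ^ 2 := by
          rw [← sq_abs (a y)]
          exact pow_le_pow_left₀ (abs_nonneg _) (hA y) 2
        have h2 : 0 ≤ ((bp - bm) / 2) ^ 2 := sq_nonneg _
        nlinarith

/-! ### First-step peeling -/

/-- The sum functional `∑_{l<n} h(X^y_l, B_l)` as a function of the disorder.
[cite: AjankiHuveneers2011, Lemma 4.2 eq. (4.2)] -/
def chainSum (w : ℝ) (h : ℝ → ℝ → ℝ) (y : ℝ) (n : ℕ) (B : Fin n → ℝ) : ℝ :=
  ∑ l ∈ Finset.range n, h (ahPhase w y (finExt B) l) (finExt B l)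

/-- One-step decomposition: `∑_{l<n+1} h(X^y_l, B_l)(b :: B') = h(y,b) + ∑_{l<n} h(X^{f_b(y)}_l, B'_l)(B')`.
[cite: AjankiHuveneers2011, Def. 3.3 (Markov property)] -/
theorem chainSum_cons (w : ℝ) (h : ℝ → ℝ → ℝ) (y : ℝ) (n : ℕ) (b : ℝ) (B' : Fin n → ℝ) :
    chainSum w h y (n + 1) (Fin.cons b B') = h y b + chainSum w h (ahStep w b y) n B' := by
  unfold chainSum
  rw [Finset.sum_range_succ']
  simp only [ahPhase_finExt_cons, finExt_cons_zero, finExt_cons_succ, ahPhase_zero]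
  ring

/-- Measurability of the sum functional. [folklore] -/
theorem measurable_chainSum (w : ℝ) {h : ℝ → ℝ → ℝ} (hh : Measurable (Function.uncurry h))
    (y : ℝ) (n : ℕ) : Measurable (chainSum w h y n) := by
  unfold chainSum
  refine Finset.measurable_sum _ fun l _ => ?_
  exact hh.comp ((measurable_ahPhase_pi w y l).prodMk (measurable_finExt l))

/-- **First-step peeling**: if `∫ e^{h(y,b)} ρ_B(db) ≤ θ` for every `y`, then
`∫ exp(∑_{l<n} h(X^y_l, B_l)) dρ_B^{⊗n} ≤ θⁿ` for every `n` and every start `y`.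
[cite: AjankiHuveneers2011, Lemma 4.2 and App. 7.2 ("Iterating this finishes the proof")] -/
theorem lintegral_exp_chainSum_le (w : ℝ) {h : ℝ → ℝ → ℝ} (hh : Measurable (Function.uncurry h))
    (ρB : Measure ℝ) [IsProbabilityMeasure ρB] (θ : ℝ≥0∞)
    (hθ : ∀ y, ∫⁻ b, ENNReal.ofReal (Real.exp (h y b)) ∂ρB ≤ θ) :
    ∀ (n : ℕ) (y : ℝ), ∫⁻ B, ENNReal.ofReal (Real.exp (chainSum w h y n B))
      ∂(Measure.pi fun _ : Fin n => ρB) ≤ θ ^ n := by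
  intro n
  induction n with
  | zero =>
    intro y
    simp [chainSum]
  | succ n ih =>
    intro y
    set g : (Fin (n + 1) → ℝ) → ℝ≥0∞ := fun B => ENNReal.ofReal (Real.exp (chainSum w h y (n + 1) B))
      with hg
    have hgm : Measurable g :=
      ENNReal.measurable_ofReal.comp (Real.measurable_exp.comp (measurable_chainSum w hh y (n + 1)))
    have hcons : ∀ (b : ℝ) (B' : Fin n → ℝ), g (Fin.cons b B') =
        ENNReal.ofReal (Real.exp (h y b)) *
          ENNReal.ofReal (Real.exp (chainSum w h (ahStep w b y) n B')) := by
      intro b B'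
      rw [hg]
      dsimp only
      rw [chainSum_cons, Real.exp_add, ENNReal.ofReal_mul (Real.exp_pos _).le]
    show ∫⁻ B, g B ∂(Measure.pi fun _ : Fin (n + 1) => ρB) ≤ θ ^ (n + 1)
    rw [ig_lintegral_pi_succ ρB n hgm]
    calc ∫⁻ b, ∫⁻ B', g (Fin.cons b B') ∂(Measure.pi fun _ : Fin n => ρB) ∂ρB
        = ∫⁻ b, ENNReal.ofReal (Real.exp (h y b)) *
            ∫⁻ B', ENNReal.ofReal (Real.exp (chainSum w h (ahStep w b y) n B'))
              ∂(Measure.pi fun _ : Fin n => ρB) ∂ρB := by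
          refine lintegral_congr fun b => ?_
          rw [← lintegral_const_mul' _ _ ENNReal.ofReal_ne_top]
          exact lintegral_congr fun B' => hcons b B'
      _ ≤ ∫⁻ b, ENNReal.ofReal (Real.exp (h y b)) * θ ^ n ∂ρB :=
          lintegral_mono fun b => mul_le_mul' le_rfl (ih (ahStep w b y))
      _ = (∫⁻ b, ENNReal.ofReal (Real.exp (h y b)) ∂ρB) * θ ^ n := by
          have hmb : Measurable fun b : ℝ => ENNReal.ofReal (Real.exp (h y b)) :=
            ENNReal.measurable_ofReal.comp
              (Real.measurable_exp.comp (hh.comp (measurable_const.prodMk measurable_id)))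
          rw [lintegral_mul_const'' (θ ^ n) (f := fun b => ENNReal.ofReal (Real.exp (h y b)))
            hmb.aemeasurable]
      _ ≤ θ * θ ^ n := mul_le_mul' (hθ y) le_rfl
      _ = θ ^ (n + 1) := by rw [pow_succ, mul_comm]

/-! ### Exponential moments and tails of predictable sums -/

/-- **Exponential moment of a sum with a predictable linear majorant**: if
`h(y,b) ≤ a(y) b + K` on `[b₋, b₊]` with `|a| ≤ A`, then
`∫⁻ exp(∑_{l<n} h(X^y_l, B_l)) dρ_B^{⊗n} ≤ e^{n(K + s²A²/2)}`.
[cite: AjankiHuveneers2011, Lemma 4.2 eq. (4.4)] -/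
theorem lintegral_exp_chainSum_le_exp (hτ : ReducedLawHyp τ bm bp) {ρB : Measure ℝ}
    [IsProbabilityMeasure ρB] (hρ : ρB = volume.withDensity fun s => ENNReal.ofReal (τ s))
    (w : ℝ) {h : ℝ → ℝ → ℝ} (hh : Measurable (Function.uncurry h)) {a : ℝ → ℝ} {A K : ℝ}
    (hA : ∀ y, |a y| ≤ A) (hmaj : ∀ y, ∀ b ∈ Set.Icc bm bp, h y b ≤ a y * b + K) (n : ℕ) (y : ℝ) :
    ∫⁻ B, ENNReal.ofReal (Real.exp (chainSum w h y n B)) ∂(Measure.pi fun _ : Fin n => ρB) ≤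
      ENNReal.ofReal (Real.exp (n * (K + ((bp - bm) / 2) ^ 2 * A ^ 2 / 2))) := by
  have h1 := lintegral_exp_chainSum_le w hh ρB _ (lintegral_exp_le_of_linear_bound hτ hρ hA hmaj) n y
  refine h1.trans (le_of_eq ?_)
  rw [← ENNReal.ofReal_pow (Real.exp_pos _).le, ← Real.exp_nat_mul]

/-- **Integrability and the real-valued bound.** [cite: AjankiHuveneers2011, Lemma 4.2 eq. (4.4)] -/
theorem integral_exp_chainSum_le (hτ : ReducedLawHyp τ bm bp) {ρB : Measure ℝ}
    [IsProbabilityMeasure ρB] (hρ : ρB = volume.withDensity fun s => ENNReal.ofReal (τ s))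
    (w : ℝ) {h : ℝ → ℝ → ℝ} (hh : Measurable (Function.uncurry h)) {a : ℝ → ℝ} {A K : ℝ}
    (hA : ∀ y, |a y| ≤ A) (hmaj : ∀ y, ∀ b ∈ Set.Icc bm bp, h y b ≤ a y * b + K) (n : ℕ) (y : ℝ) :
    Integrable (fun B => Real.exp (chainSum w h y n B)) (Measure.pi fun _ : Fin n => ρB) ∧
      ∫ B, Real.exp (chainSum w h y n B) ∂(Measure.pi fun _ : Fin n => ρB) ≤
        Real.exp (n * (K + ((bp - bm) / 2) ^ 2 * A ^ 2 / 2)) := by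
  have hbd := lintegral_exp_chainSum_le_exp hτ hρ w hh hA hmaj n y
  have hmeas : AEStronglyMeasurable (fun B => Real.exp (chainSum w h y n B))
      (Measure.pi fun _ : Fin n => ρB) :=
    (Real.measurable_exp.comp (measurable_chainSum w hh y n)).aestronglyMeasurable
  have hfin : HasFiniteIntegral (fun B => Real.exp (chainSum w h y n B))
      (Measure.pi fun _ : Fin n => ρB) := by
    rw [hasFiniteIntegral_iff_ofReal (ae_of_all _ fun B => (Real.exp_pos _).le)]
    exact lt_of_le_of_lt hbd ENNReal.ofReal_lt_top
  have hint : Integrable (fun B => Real.exp (chainSum w h y n B)) (Measure.pi fun _ : Fin n => ρB) :=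
    ⟨hmeas, hfin⟩
  refine ⟨hint, ?_⟩
  have h2 := (ENNReal.ofReal_le_ofReal_iff (Real.exp_pos _).le).mp
    (by rwa [ofReal_integral_eq_lintegral_ofReal hint (ae_of_all _ fun B => (Real.exp_pos _).le)])
  exact h2

/-- **Azuma-type tail bound**: for `|a| ≤ A` and `t ≥ 0`, `n ≥ 1`,
`ρ_B^{⊗n}{∑_{l<n} a(X^y_l) B_l ≥ t} ≤ exp(-t²/(2 n s² A²))` (`s = (b₊-b₋)/2`, `A > 0`).
[cite: AjankiHuveneers2011, Lemma 4.2 eq. (4.4) with Markov's inequality (as in (5.4), (6.2))] -/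
theorem measure_chainSum_ge_le (hτ : ReducedLawHyp τ bm bp) {ρB : Measure ℝ}
    [IsProbabilityMeasure ρB] (hρ : ρB = volume.withDensity fun s => ENNReal.ofReal (τ s))
    (w : ℝ) {a : ℝ → ℝ} (ha : Measurable a) {A : ℝ} (hApos : 0 < A) (hA : ∀ y, |a y| ≤ A)
    {n : ℕ} (hn : 1 ≤ n) (y : ℝ) {t : ℝ} (ht : 0 ≤ t) :
    (Measure.pi fun _ : Fin n => ρB).real
        {B | t ≤ chainSum w (fun x b => a x * b) y n B} ≤
      Real.exp (-(t ^ 2 / (2 * n * ((bp - bm) / 2) ^ 2 * A ^ 2))) := by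
  set s2 : ℝ := ((bp - bm) / 2) ^ 2 with hs2
  have hs2pos : 0 < s2 := by rw [hs2]; have := hτ.lt; positivity
  have hnpos : (0 : ℝ) < n := by exact_mod_cast hn
  -- exponential Markov with parameter `lam = t/(n s² A²)`
  set lam : ℝ := t / (n * s2 * A ^ 2) with hlam
  have hlam0 : 0 ≤ lam := by rw [hlam]; positivity
  have hmeas : Measurable (Function.uncurry fun x b => lam * (a x * b)) := by
    exact measurable_const.mul ((ha.comp measurable_fst).mul measurable_snd)
  have hmaj : ∀ x, ∀ b ∈ Set.Icc bm bp, (fun x b => lam * (a x * b)) x b ≤ (lam * a x) * b + 0 := by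
    intro x b _; simp only; linarith [le_refl (lam * a x * b)]
  have hA' : ∀ x, |lam * a x| ≤ lam * A := fun x => by
    rw [abs_mul, abs_of_nonneg hlam0]; exact mul_le_mul_of_nonneg_left (hA x) hlam0
  obtain ⟨hint, hbound⟩ := integral_exp_chainSum_le hτ hρ w hmeas hA' hmaj n y
  have hsum : ∀ B : Fin n → ℝ, chainSum w (fun x b => lam * (a x * b)) y n B =
      lam * chainSum w (fun x b => a x * b) y n B := by
    intro B; unfold chainSum; rw [Finset.mul_sum]
  -- Markov's inequality
  set μ := (Measure.pi fun _ : Fin n => ρB) with hμ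
  have hmk : μ.real {B | t ≤ chainSum w (fun x b => a x * b) y n B} ≤
      Real.exp (-(lam * t)) * ∫ B, Real.exp (chainSum w (fun x b => lam * (a x * b)) y n B) ∂μ := by
    have hsub : {B | t ≤ chainSum w (fun x b => a x * b) y n B} ⊆
        {B | Real.exp (lam * t) ≤ Real.exp (chainSum w (fun x b => lam * (a x * b)) y n B)} := by
      intro B hB
      simp only [Set.mem_setOf_eq] at hB ⊢
      rw [hsum]
      exact Real.exp_le_exp.mpr (mul_le_mul_of_nonneg_left hB hlam0)
    calc μ.real {B | t ≤ chainSum w (fun x b => a x * b) y n B}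
        ≤ μ.real {B | Real.exp (lam * t) ≤ Real.exp (chainSum w (fun x b => lam * (a x * b)) y n B)} :=
          measureReal_mono hsub
      _ ≤ (∫ B, Real.exp (chainSum w (fun x b => lam * (a x * b)) y n B) ∂μ) / Real.exp (lam * t) :=
          mul_meas_ge_le_integral_of_nonneg (ae_of_all _ fun B => (Real.exp_pos _).le) hint _ |>
            (fun h => by
              rw [le_div_iff₀ (Real.exp_pos _), mul_comm]
              exact h)
      _ = Real.exp (-(lam * t)) * ∫ B, Real.exp (chainSum w (fun x b => lam * (a x * b)) y n B) ∂μ := by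
          rw [Real.exp_neg, div_eq_inv_mul]
  refine hmk.trans ?_
  calc Real.exp (-(lam * t)) * ∫ B, Real.exp (chainSum w (fun x b => lam * (a x * b)) y n B) ∂μ
      ≤ Real.exp (-(lam * t)) * Real.exp (n * (0 + s2 * (lam * A) ^ 2 / 2)) :=
        mul_le_mul_of_nonneg_left hbound (Real.exp_pos _).le
    _ = Real.exp (-(t ^ 2 / (2 * n * s2 * A ^ 2))) := by
        rw [← Real.exp_add]
        congr 1
        rw [hlam]
        field_simp
        ring

end Literature.Barriers.AtomisticToContinuum.HeatConduction

end
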